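import Literature.Geometry.Kaehler.ComplexTorusLefschetzAlgebraCorrespondences
import Literature.Geometry.Kaehler.ComplexTorusSymplecticPresentation
import HarnessLib

/-!
# Milne 1999, Theorem 5.9 and Voisin's class of `(L^{n-k})⁻¹` for EVERY polarised complex torus:
# the Lefschetz-correspondence dictionary is presentation-free

`Literature.Geometry.Kaehler.ComplexTorusLefschetzAlgebraCorrespondences` proves Milne's Theorem 5.9 —
every operator of the algebra `ℚ⟨L, ᶜΛ⟩` (`ᶜΛ`, Kleiman's `Λ`, `∗`, `∗⁻¹`, the primitive projectors
`π_{m,r} = ᵖp_{2g-m-2r}`, `Λᵗ = (Lᵗ)⁻¹`) is `ᵗγ` for a **Lefschetz class** `γ ∈ D•(X × X)` — and Voisin's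
remark (2002, p. 287: the Hodge class of `(L^{n-k})⁻¹`) for a complex torus `X = E/Φ(ℤ^ι)` polarised by a
Riemann form `η` **in a symplectic presentation** (`IsSymplecticEnum Φ e₀ η d`: the lattice basis is
symplectic for `η`) and for **positively oriented** enumerations `e₁`. Both provisos are artefacts of the
period-matrix model, and this file removes them:

* §1 `corrMapT_eq_of_enum₁`: `ᵗγ = corrMapT Φ₁ Φ₂ e₁ e γ` does not depend on the enumeration `e₁` of the
  lattice basis of `X₁` at all (`∫_{X₁}` carries the complex orientation), so "positively oriented" can be
  dropped everywhere.
* §2 two presentations `Φ : ℝ^ι ≃ E`, `Φ' : ℝ^{ι'} ≃ E` of the same torus (same lattice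
  `Φ(ℤ^ι) = Φ'(ℤ^{ι'})`) have the same `∫_X` (`torusIntegral_eq_of_range_latticeVec_eq`: the identity is
  `ρ_r(A)` for a unimodular integer `A`, `exists_realRep_eq_id`, and the transformation formula of row A4-27),
  the same product lattice (`range_latticeVec_prodPeriod_eq`), hence the same `ᵗγ`
  (`corrMapT_eq_of_range_latticeVec_eq`) and the same `D•` (`divisorClasses_eq_of_range_latticeVec_eq`):
  **"`u` is induced by a Lefschetz correspondence" is presentation-free**
  (`exists_mem_divisorClasses_corrMapT_iff_of_range_latticeVec_eq`).
* §3 consequently Theorem 5.9 holds for EVERY polarised complex torus — hypothesis `IsRiemannForm Φ η` only,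
  any lattice basis, any enumerations — by transport from a symplectic re-presentation of the same lattice
  (`IsRiemannForm.exists_isSymplecticEnum`, elementary divisors; the point `dim X = 0` is treated directly):
  `IsRiemannForm.exists_mem_divisorClasses_corrMapT_eq_lefschetzDual / _kleimanDual / _primitiveProj /
  _lefschetzSignOp / _lefschetzStar / _kleimanDualPow`, the kernel classes
  `IsRiemannForm.corrClass_lefschetzDual/kleimanDual/primitiveProj/kleimanDualPow_domDomCongr_mem_divisorClasses`,
  and the headline **`IsRiemannForm.corrClass_lefschetzInv_mem_divisorClasses`**: under EXACTLY the hypotheses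
  of row A4-49's `IsRiemannForm.corrClass_lefschetzInv_mem_hodgeClassesIn` (a Riemann form `η`, `k + j = g`,
  any `f`, any left inverse `u` of `Lʲ` on `Hᵏ`) the class `γ_u ∈ H^{2k}(X × X)` is not merely a Hodge class
  but a Lefschetz class, `γ_u ∈ Dᵏ(X × X)` — Voisin's question ("we do not know whether the corresponding
  Hodge class satisfies the Hodge conjecture", p. 287) answered for abelian varieties at torus level, as Milne's
  Theorem 5.9 / Remark 5.11 (Lieberman 1968, Kleiman 1968 (2A11)) predict.

* §4 `D•(X)` is a module over the Lefschetz algebra, for every polarised complex torus (Prop. 5.7 with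
  Thm. 5.9): `IsRiemannForm.lefschetzDual_apply_mem_divisorClasses` (`ᶜΛ D^{s+1} ⊆ Dˢ`),
  `…kleimanDual_apply_mem_divisorClasses`, `…primitiveProj_apply_mem_divisorClasses` (`π_{2s,r} Dˢ ⊆ Dˢ`),
  `…lefschetzStar_apply_mem_divisorClasses` (`∗ Dˢ ⊆ D^{j+s}`).
* §5 example: for a product `X₁ × X₂` of polarised tori (polarisation `p₁^*ω₁ + p₂^*ω₂`, for which the
  product lattice basis is NOT symplectic) Kleiman's `Λ` is Lefschetz-induced
  (`IsRiemannForm.exists_mem_divisorClasses_corrMapT_eq_kleimanDual_prod`).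

References: J. S. Milne, *Lefschetz classes on abelian varieties*, Duke Math. J. 96 (1999), §5 (Prop. 5.7,
Thm. 5.9, Rem. 5.11); C. Voisin, *Hodge Theory and Complex Algebraic Geometry I* (2002), §11.3.3 p. 287;
S. Kleiman, *Algebraic cycles and the Weil conjectures* (1968), §1.4, §2 (2A11); H. Lange, *Abelian
Varieties over the Complex Numbers* (2023), §1.2.1, §1.7.2, §2.5.3, §6.2.4.

Carrier: Layer-A2 lattice/period-matrix model `ComplexTorus`; theorems only; NO definition, NO named fact.
-/

noncomputable section

set_option maxSynthPendingDepth 3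

open Module Complex Function Finset
open Literature.LinearAlgebra.Alternating

namespace Literature.Geometry.Kaehler

namespace ComplexTorus

/-! ## §1 `γ^*` does not depend on the orientation of the enumeration `e₁` -/

section Enum

variable {ι₁ ι₂ : Type*} [Fintype ι₁] [Fintype ι₂] [DecidableEq ι₁] [DecidableEq ι₂]
  {E₁ E₂ : Type*} [NormedAddCommGroup E₁] [NormedSpace ℂ E₁] [NormedAddCommGroup E₂] [NormedSpace ℂ E₂]
  (Φ₁ : (ι₁ → ℝ) ≃L[ℝ] E₁) (Φ₂ : (ι₂ → ℝ) ≃L[ℝ] E₂) {a b d m : ℕ}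

/-- **`γ^*` does not depend on the enumeration `e₁` of the lattice basis of `X₁`** (not even on its
orientation): `∫_{X₁}` carries the complex orientation (`torusIntegral_eq_torusIntegral`) and `γ^*ξ` is
characterised by `∫_{X₁} η ∧ γ^*ξ = ∫_{X₁ × X₂} (pr₁^*η ∧ pr₂^*ξ) ∧ γ`.
[cite: Lange2023AbelianVarietiesComplex, §6.2.4 (p. 310)] [cite: Voisin2002, §11.3.3 (11.11)] -/
theorem corrMapT_eq_of_enum₁ (e₁ e₁' : Fin (a + d) ≃ ι₁) (e : Fin ((a + b) + m) ≃ ι₁ ⊕ ι₂)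
    (γ : (E₁ × E₂) [⋀^Fin m]→L[ℝ] ℂ) : corrMapT Φ₁ Φ₂ e₁ e γ = corrMapT Φ₁ Φ₂ e₁' e γ := by
  refine LinearMap.ext fun ξ ↦ eq_corrMapT_of_forall Φ₁ Φ₂ e₁' e γ ξ fun η ↦ ?_
  rw [torusIntegral_eq_torusIntegral Φ₁ e₁' e₁, torusIntegral_wedge_corrMapT]

end Enum

/-! ## §2 Presentations with the same lattice: `∫_X`, `γ^*` and `D•` are unchanged -/

section Presentation

variable {ι ι' : Type*} [Fintype ι] [Fintype ι'] [DecidableEq ι] [DecidableEq ι']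
  {E : Type*} [NormedAddCommGroup E] [NormedSpace ℂ E]
  (Φ : (ι → ℝ) ≃L[ℝ] E) (Φ' : (ι' → ℝ) ≃L[ℝ] E)

omit [Fintype ι'] [DecidableEq ι'] in
/-- **If `Λ(Φ) ⊆ Λ(Φ')`, the identity of `E` is the real representation `ρ_r(A)` of an integer matrix `A`**
(the `Φ`-basis of the lattice written in the `Φ'`-basis; Lange §1.2.1: the rational representation of a
homomorphism — here of `1_X` between two presentations).
[cite: Lange2023AbelianVarietiesComplex, §1.2.1 (rational and analytic representations)] -/
theorem exists_realRep_eq_id (hr : Set.range (latticeVec Φ) ⊆ Set.range (latticeVec Φ')) :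
    ∃ A : Matrix ι' ι ℤ, realRep Φ Φ' A = ContinuousLinearMap.id ℝ E := by
  choose m hm using fun i : ι ↦ hr ⟨Pi.single i 1, rfl⟩
  refine ⟨Matrix.of fun j i ↦ m i j, ContinuousLinearMap.ext fun v ↦ ?_⟩
  obtain ⟨x, rfl⟩ := Φ.surjective v
  rw [realRep_apply, ContinuousLinearMap.id_apply]
  -- both sides are `ℝ`-linear in `x`: compare on the standard basis
  suffices h : ((Φ' : (ι' → ℝ) →L[ℝ] E) : (ι' → ℝ) →ₗ[ℝ] E) ∘ₗ
      Matrix.mulVecLin ((Matrix.of fun j i ↦ m i j).map (Int.cast : ℤ → ℝ)) =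
      ((Φ : (ι → ℝ) →L[ℝ] E) : (ι → ℝ) →ₗ[ℝ] E) from LinearMap.congr_fun h x
  refine (Pi.basisFun ℝ ι).ext fun i ↦ ?_
  rw [LinearMap.comp_apply, Pi.basisFun_apply, Matrix.mulVecLin_apply, Matrix.mulVec_single_one]
  change Φ' (fun j ↦ ((m i j : ℤ) : ℝ)) = Φ (Pi.single i 1)
  rw [← latticeVec_single]
  exact hm i

/-- **`∫_X` only depends on the lattice** (and the complex structure): two presentations
`Φ : ℝ^ι ≃ E`, `Φ' : ℝ^{ι'} ≃ E` with the same lattice have the same `∫_X` on invariant top forms, in any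
enumerations (transformation formula `∫_X 1_X^*θ = |det A| ∫_X θ` of row A4-27 in both directions, and
`∫_X vol_X = 1`). [cite: Lange2023AbelianVarietiesComplex, §1.7.2 Cor. 1.7.6 (proof) and §6.2.4 p. 310] -/
theorem torusIntegral_eq_of_range_latticeVec_eq (hr : Set.range (latticeVec Φ') = Set.range (latticeVec Φ))
    {N : ℕ} (e : Fin N ≃ ι) (e' : Fin N ≃ ι') (θ : E [⋀^Fin N]→L[ℝ] ℂ) :
    torusIntegral Φ' e' θ = torusIntegral Φ e θ := by
  obtain ⟨A, hA⟩ := exists_realRep_eq_id Φ Φ' hr.ge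
  obtain ⟨B, hB⟩ := exists_realRep_eq_id Φ' Φ hr.le
  have hAc : ∀ (c : ℂ) (u : E), realRep Φ Φ' A (c • u) = c • realRep Φ Φ' A u := fun c u ↦ by
    rw [hA]; rfl
  have hBc : ∀ (c : ℂ) (u : E), realRep Φ' Φ B (c • u) = c • realRep Φ' Φ B u := fun c u ↦ by
    rw [hB]; rfl
  have h₁ : ∀ θ : E [⋀^Fin N]→L[ℝ] ℂ, torusIntegral Φ e θ =
      ((A.submatrix e' e).det.natAbs : ℂ) * torusIntegral Φ' e' θ := fun θ ↦ by
    have h := torusIntegral_comp_realRep Φ Φ' A hAc e e' θ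
    rwa [hA, show θ.compContinuousLinearMap (ContinuousLinearMap.id ℝ E) = θ from by ext; rfl] at h
  have h₂ : ∀ θ : E [⋀^Fin N]→L[ℝ] ℂ, torusIntegral Φ' e' θ =
      ((B.submatrix e e').det.natAbs : ℂ) * torusIntegral Φ e θ := fun θ ↦ by
    have h := torusIntegral_comp_realRep Φ' Φ B hBc e' e θ
    rwa [hB, show θ.compContinuousLinearMap (ContinuousLinearMap.id ℝ E) = θ from by ext; rfl] at h
  -- on `vol_X`: `1 = |det A| |det B|`, so `|det B| = 1`
  have hvol := h₂ (volumeForm Φ e)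
  rw [torusIntegral_volumeForm] at hvol
  have hone : ((A.submatrix e' e).det.natAbs : ℂ) * ((B.submatrix e e').det.natAbs : ℂ) = 1 := by
    have h := h₁ (volumeForm Φ e)
    rw [torusIntegral_volumeForm, hvol, mul_one] at h
    exact h.symm
  have hnat : (A.submatrix e' e).det.natAbs * (B.submatrix e e').det.natAbs = 1 := by
    exact_mod_cast hone
  rw [h₂ θ, Nat.eq_one_of_mul_eq_one_left hnat, Nat.cast_one, one_mul]

omit [DecidableEq ι] [DecidableEq ι'] in
/-- Product presentations with the same lattices in each factor have the same product lattice.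
[cite: LangeBirkenhake1992, §5.3] -/
theorem range_latticeVec_prodPeriod_subset {κ κ' : Type*} [Fintype κ] [Fintype κ'] {F : Type*}
    [NormedAddCommGroup F] [NormedSpace ℂ F] {Ψ : (κ → ℝ) ≃L[ℝ] F} {Ψ' : (κ' → ℝ) ≃L[ℝ] F}
    (hr : Set.range (latticeVec Φ') ⊆ Set.range (latticeVec Φ))
    (hs : Set.range (latticeVec Ψ') ⊆ Set.range (latticeVec Ψ)) :
    Set.range (latticeVec (prodPeriod Φ' Ψ')) ⊆ Set.range (latticeVec (prodPeriod Φ Ψ)) := by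
  rintro _ ⟨m, rfl⟩
  obtain ⟨m₁, h₁⟩ := hr ⟨fun i ↦ m (Sum.inl i), rfl⟩
  obtain ⟨m₂, h₂⟩ := hs ⟨fun j ↦ m (Sum.inr j), rfl⟩
  refine ⟨Sum.elim m₁ m₂, ?_⟩
  rw [latticeVec_prodPeriod, latticeVec_prodPeriod, ← h₁, ← h₂]
  rfl

omit [DecidableEq ι] [DecidableEq ι'] in
/-- Equal lattices in the factors give equal product lattices. [cite: LangeBirkenhake1992, §5.3] -/
theorem range_latticeVec_prodPeriod_eq {κ κ' : Type*} [Fintype κ] [Fintype κ'] {F : Type*}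
    [NormedAddCommGroup F] [NormedSpace ℂ F] {Ψ : (κ → ℝ) ≃L[ℝ] F} {Ψ' : (κ' → ℝ) ≃L[ℝ] F}
    (hr : Set.range (latticeVec Φ') = Set.range (latticeVec Φ))
    (hs : Set.range (latticeVec Ψ') = Set.range (latticeVec Ψ)) :
    Set.range (latticeVec (prodPeriod Φ' Ψ')) = Set.range (latticeVec (prodPeriod Φ Ψ)) :=
  le_antisymm (range_latticeVec_prodPeriod_subset Φ Φ' hr.le hs.le)
    (range_latticeVec_prodPeriod_subset Φ' Φ hr.ge hs.ge)

/-- **`γ^*` only depends on the lattice**: for two presentations of `X` with the same lattice (and any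
enumerations) the operator `ᵗγ = corrMapT` of a class `γ` on `X × X` is the same.
[cite: Lange2023AbelianVarietiesComplex, §6.2.4 (p. 310)] [cite: Voisin2002, §11.3.3 (11.11)] -/
theorem corrMapT_eq_of_range_latticeVec_eq (hr : Set.range (latticeVec Φ') = Set.range (latticeVec Φ))
    {a b d m : ℕ} (e₁ : Fin (a + d) ≃ ι) (e : Fin ((a + b) + m) ≃ ι ⊕ ι) (e₁' : Fin (a + d) ≃ ι')
    (e' : Fin ((a + b) + m) ≃ ι' ⊕ ι') (γ : (E × E) [⋀^Fin m]→L[ℝ] ℂ) :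
    corrMapT Φ' Φ' e₁' e' γ = corrMapT Φ Φ e₁ e γ := by
  refine LinearMap.ext fun ξ ↦ eq_corrMapT_of_forall Φ Φ e₁ e γ ξ fun η ↦ ?_
  rw [← torusIntegral_eq_of_range_latticeVec_eq Φ Φ' hr e₁ e₁', torusIntegral_wedge_corrMapT,
    torusIntegral_eq_of_range_latticeVec_eq (prodPeriod Φ Φ) (prodPeriod Φ' Φ')
      (range_latticeVec_prodPeriod_eq Φ Φ' hr hr) e e']

omit [Fintype ι] [Fintype ι'] [DecidableEq ι] [DecidableEq ι'] in
/-- **`D•` only depends on the lattice**: `Dᵖ` for `Φ` lies in `Dᵖ` for every presentation `Φ'` whose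
lattice lies in `Λ(Φ)` (its Néron–Severi forms are Néron–Severi for `Φ'`, `IsNSForm.of_range_latticeVec_subset`).
[cite: Lange2023AbelianVarietiesComplex, §7.3.1 and §1.2.2 Prop. 1.2.9] -/
theorem divisorClasses_le_of_range_latticeVec_subset (hr : Set.range (latticeVec Φ') ⊆ Set.range (latticeVec Φ))
    (p : ℕ) : divisorClasses Φ p ≤ divisorClasses Φ' p := by
  refine Submodule.span_le.2 ?_
  rintro _ ⟨θ, rfl⟩
  exact wedgeFamily_mem_divisorClasses Φ' _ fun i ↦ (θ i).2.of_range_latticeVec_subset hr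

omit [Fintype ι] [Fintype ι'] [DecidableEq ι] [DecidableEq ι'] in
/-- Equal lattices give equal `D•`. [cite: Lange2023AbelianVarietiesComplex, §7.3.1] -/
theorem divisorClasses_eq_of_range_latticeVec_eq (hr : Set.range (latticeVec Φ') = Set.range (latticeVec Φ))
    (p : ℕ) : divisorClasses Φ' p = divisorClasses Φ p :=
  le_antisymm (divisorClasses_le_of_range_latticeVec_subset Φ' Φ hr.ge p)
    (divisorClasses_le_of_range_latticeVec_subset Φ Φ' hr.le p)

/-- **The dictionary is presentation-free**: "`u` is induced by a Lefschetz correspondence" (`∃ γ ∈ Dʳ(X × X),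
ᵗγ = u`) means the same thing for any two presentations of `X` with the same lattice and any enumerations.
[cite: Milne1999LefschetzClasses, §5 p. 664 (Lefschetz correspondences)] -/
theorem exists_mem_divisorClasses_corrMapT_iff_of_range_latticeVec_eq
    (hr : Set.range (latticeVec Φ') = Set.range (latticeVec Φ)) {a b d r : ℕ} (e₁ : Fin (a + d) ≃ ι)
    (e : Fin ((a + b) + 2 * r) ≃ ι ⊕ ι) (e₁' : Fin (a + d) ≃ ι') (e' : Fin ((a + b) + 2 * r) ≃ ι' ⊕ ι')
    (u : (E [⋀^Fin b]→L[ℝ] ℂ) →ₗ[ℂ] (E [⋀^Fin d]→L[ℝ] ℂ)) :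
    (∃ γ ∈ divisorClasses (prodPeriod Φ' Φ') r, corrMapT Φ' Φ' e₁' e' γ = u) ↔
      ∃ γ ∈ divisorClasses (prodPeriod Φ Φ) r, corrMapT Φ Φ e₁ e γ = u := by
  rw [divisorClasses_eq_of_range_latticeVec_eq (prodPeriod Φ Φ) (prodPeriod Φ' Φ')
    (range_latticeVec_prodPeriod_eq Φ Φ' hr hr)]
  simp_rw [corrMapT_eq_of_range_latticeVec_eq Φ Φ' hr e₁ e e₁' e']

end Presentation

/-! ## §3 Theorem 5.9 and Voisin's class for EVERY polarised complex torus (`IsRiemannForm Φ η` only) -/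

section AnyBasis

universe uE

variable {ι : Type*} [Fintype ι] [DecidableEq ι] {E : Type uE} [NormedAddCommGroup E] [NormedSpace ℂ E]
  [FiniteDimensional ℂ E] (Φ : (ι → ℝ) ≃L[ℝ] E) {η : E [⋀^Fin 2]→L[ℝ] ℝ}

omit [DecidableEq ι] [FiniteDimensional ℂ E] in
include Φ in
/-- Cardinality bookkeeping: `Fin (a + d) ≃ ι` forces `a + d = 2 dim_ℂ E`. [cite: Lange2023AbelianVarietiesComplex, §1.1.3] -/
private theorem add_eq_two_mul_finrank' {a d : ℕ} (e₁ : Fin (a + d) ≃ ι) : a + d = 2 * finrank ℂ E := by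
  have h := finrank_complex_mul_two Φ e₁
  omega

omit [DecidableEq ι] [FiniteDimensional ℂ E] in
include Φ in
/-- `|ι| = |Fin g ⊕ Fin g|` for `g = dim_ℂ E`. [cite: Lange2023AbelianVarietiesComplex, §1.1.3] -/
private theorem card_eq_card_sum {a d g : ℕ} (e₁ : Fin (a + d) ≃ ι) (hg : finrank ℂ E = g) :
    Fintype.card ι = Fintype.card (Fin g ⊕ Fin g) := by
  have h := add_eq_two_mul_finrank' Φ e₁
  have h' := Fintype.card_congr e₁
  simp only [Fintype.card_fin, Fintype.card_sum] at h' ⊢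
  omega

omit [FiniteDimensional ℂ E] in
/-- **A symplectic presentation of dimension `n + 1`** (`IsRiemannForm.exists_isSymplecticEnum`, with the
dimension read off): same lattice, `η` still a Riemann form, symplectic basis of type `d`.
[cite: Lange2023AbelianVarietiesComplex, §2.5.3 and §1.5.1 (elementary divisors)] -/
theorem IsRiemannForm.exists_isSymplecticEnum_of_finrank_eq (hη : IsRiemannForm Φ η) {n : ℕ}
    (hn : finrank ℂ E = n + 1) :
    ∃ (d : Fin (n + 1) → ℕ) (Φ' : ((Fin (n + 1) ⊕ Fin (n + 1)) → ℝ) ≃L[ℝ] E),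
      Set.range (latticeVec Φ') = Set.range (latticeVec Φ) ∧ IsRiemannForm Φ' η ∧
        IsSymplecticEnum Φ' (Equiv.refl _) η d := by
  obtain ⟨g, d, Φ', hr, hη', hs⟩ := hη.exists_isSymplecticEnum
  have hg : g = n + 1 := by
    have h := finrank_complex_mul_two Φ' (finSumFinEquiv.symm : Fin (g + g) ≃ Fin g ⊕ Fin g)
    omega
  subst hg
  exact ⟨d, Φ', hr, hη', hs⟩

variable (hη : IsRiemannForm Φ η)
include hη

omit [FiniteDimensional ℂ E] in
/-- **The transfer**: a realisation on a symplectic presentation `Φ'` of the same torus (same lattice) is a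
realisation on `Φ`, for any enumerations `e₁, e` on the `Φ`-side. [cite: Milne1999LefschetzClasses, §5 p. 664] -/
theorem IsRiemannForm.exists_mem_divisorClasses_corrMapT_of_symplectic {n : ℕ} (hn : finrank ℂ E = n + 1)
    {a b c r : ℕ} (e₁ : Fin (a + c) ≃ ι) (e : Fin ((a + b) + 2 * r) ≃ ι ⊕ ι)
    (u : (E [⋀^Fin b]→L[ℝ] ℂ) →ₗ[ℂ] (E [⋀^Fin c]→L[ℝ] ℂ))
    (H : ∀ (d : Fin (n + 1) → ℕ) (Φ' : ((Fin (n + 1) ⊕ Fin (n + 1)) → ℝ) ≃L[ℝ] E),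
      IsRiemannForm Φ' η → IsSymplecticEnum Φ' (Equiv.refl _) η d →
      ∀ (e₁' : Fin (a + c) ≃ Fin (n + 1) ⊕ Fin (n + 1)), orientationSign Φ' e₁' = 1 →
      ∀ (e' : Fin ((a + b) + 2 * r) ≃ (Fin (n + 1) ⊕ Fin (n + 1)) ⊕ (Fin (n + 1) ⊕ Fin (n + 1))),
      ∃ γ ∈ divisorClasses (prodPeriod Φ' Φ') r, corrMapT Φ' Φ' e₁' e' γ = u) :
    ∃ γ ∈ divisorClasses (prodPeriod Φ Φ) r, corrMapT Φ Φ e₁ e γ = u := by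
  obtain ⟨d, Φ', hr, hη', hs⟩ := hη.exists_isSymplecticEnum_of_finrank_eq Φ hn
  let τ : ι ≃ Fin (n + 1) ⊕ Fin (n + 1) := Fintype.equivOfCardEq (card_eq_card_sum Φ e₁ hn)
  obtain ⟨e₁', he₁'⟩ := exists_orientationSign_eq_one Φ' (e₁.trans τ)
  exact (exists_mem_divisorClasses_corrMapT_iff_of_range_latticeVec_eq Φ Φ' hr e₁ e e₁'
    (e.trans (τ.sumCongr τ)) u).1 (H d Φ' hη' hs e₁' he₁' _)

/-- **Theorem 5.9 for `ᶜΛ`, every polarised complex torus, any enumerations**: `ᶜΛ : H^{m+2}(X) → Hᵐ(X)` is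
`ᵗγ` for a Lefschetz class `γ ∈ D^{g-1}(X × X)` (`g = c + 1`). [cite: Milne1999LefschetzClasses, §5 Thm. 5.9]
[cite: Kleiman1968AlgebraicCycles, §2 (2A11)] -/
theorem IsRiemannForm.exists_mem_divisorClasses_corrMapT_eq_lefschetzDual {a m c : ℕ}
    (hc : finrank ℂ E = c + 1) (e₁ : Fin (a + m) ≃ ι) (e : Fin ((a + (m + 2)) + 2 * c) ≃ ι ⊕ ι) :
    ∃ γ ∈ divisorClasses (prodPeriod Φ Φ) c, corrMapT Φ Φ e₁ e γ = lefschetzDual η m :=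
  hη.exists_mem_divisorClasses_corrMapT_of_symplectic Φ hc e₁ e _ fun _ Φ' hη' hs e₁' _ e' ↦ by
    letI : LinearOrder (Fin (c + 1) ⊕ Fin (c + 1)) :=
      linearOrderOfOrientation (finSumFinEquiv.symm : Fin ((c + 1) + (c + 1)) ≃ Fin (c + 1) ⊕ Fin (c + 1))
    exact hs.exists_mem_divisorClasses_corrMapT_eq_lefschetzDual' Φ' hη' e₁' e'

/-- **Kleiman's `Λ`, every polarised complex torus**: `Λ : H^{m+2}(X) → Hᵐ(X)` is `ᵗγ`, `γ ∈ D^{g-1}(X × X)`.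
[cite: Milne1999LefschetzClasses, §5 Thm. 5.9] [cite: Kleiman1968AlgebraicCycles, §1.4] -/
theorem IsRiemannForm.exists_mem_divisorClasses_corrMapT_eq_kleimanDual {a m c : ℕ}
    (hc : finrank ℂ E = c + 1) (e₁ : Fin (a + m) ≃ ι) (e : Fin ((a + (m + 2)) + 2 * c) ≃ ι ⊕ ι) :
    ∃ γ ∈ divisorClasses (prodPeriod Φ Φ) c, corrMapT Φ Φ e₁ e γ = kleimanDual η m :=
  hη.exists_mem_divisorClasses_corrMapT_of_symplectic Φ hc e₁ e _ fun _ Φ' hη' hs e₁' he₁' e' ↦ by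
    letI : LinearOrder (Fin (c + 1) ⊕ Fin (c + 1)) :=
      linearOrderOfOrientation (finSumFinEquiv.symm : Fin ((c + 1) + (c + 1)) ≃ Fin (c + 1) ⊕ Fin (c + 1))
    exact hs.exists_mem_divisorClasses_corrMapT_eq_kleimanDual Φ' hη' e₁' he₁' e'

/-- **The primitive projectors, every polarised complex torus, any enumerations**: `π_{m,r} = ᵗγ`,
`γ ∈ Dᵍ(X × X)` (the point `g = 0` included: there `ᶜΛ ∘ L = 0` and `π_{0,r}` is a Lagrange polynomial at `0`).
[cite: Milne1999LefschetzClasses, §5 Thm. 5.9 (proof)] [cite: Kleiman1968AlgebraicCycles, §1.4 (1.4.4)] -/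
theorem IsRiemannForm.exists_mem_divisorClasses_corrMapT_eq_primitiveProj {a m g : ℕ} (hg : finrank ℂ E = g)
    (e₁ : Fin (a + m) ≃ ι) (e : Fin ((a + m) + 2 * g) ≃ ι ⊕ ι) (r : ℕ) :
    ∃ γ ∈ divisorClasses (prodPeriod Φ Φ) g, corrMapT Φ Φ e₁ e γ = primitiveProj η m r := by
  rcases Nat.eq_zero_or_eq_succ_pred g with h0 | hsucc
  · subst h0
    -- an auxiliary linear order on `ι` (keeping its decidable equality) to run the Lagrange-polynomial lemma
    letI : LinearOrder ι := linearOrderOfOrientation e₁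
    have hnd : ∀ v : E, v ≠ 0 → ∃ w : E, η ![v, w] ≠ 0 := fun v hv ↦ hη.exists_apply_ne_zero Φ v hv
    obtain ⟨e₁', he₁'⟩ := exists_orientationSign_eq_one Φ e₁
    have hcard : Fintype.card ι < m + 2 := by
      have h := add_eq_two_mul_finrank' Φ e₁; have h' := Fintype.card_congr e₁
      simp only [Fintype.card_fin] at h'; omega
    have hL : ∃ γ ∈ divisorClasses (prodPeriod Φ Φ) 0, corrMapT Φ Φ e₁' e γ = lefschetzDualL η m := by
      refine ⟨0, Submodule.zero_mem _, ?_⟩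
      rw [corrMapT_zero]
      refine (LinearMap.ext fun ξ ↦ ?_).symm
      rw [lefschetzDualL_apply, eq_zero_of_card_lt Φ (lefschetzPow η 1 _ ξ) hcard, map_zero, LinearMap.zero_apply]
    have key : ∃ γ ∈ divisorClasses (prodPeriod Φ Φ) 0, corrMapT Φ Φ e₁' e γ = primitiveProj η m r := by
      rw [primitiveProj_def]
      exact exists_mem_divisorClasses_corrMapT_eq_aeval_lagrangeBasis Φ hη.isNSForm hnd hg
        (hη.wedgePow_ne_zero Φ hg.ge) e₁' he₁' e hL
        (w := fun j ↦ lefschetzWeight (finrank ℂ E) (m + 2) (j + 1)) (fun _ ↦ rfl) _ _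
    obtain ⟨γ, hγ, hγe⟩ := key
    exact ⟨γ, hγ, by rw [corrMapT_eq_of_enum₁ Φ Φ e₁ e₁' e, hγe]⟩
  · obtain ⟨n, rfl⟩ : ∃ n, g = n + 1 := ⟨_, hsucc⟩
    exact hη.exists_mem_divisorClasses_corrMapT_of_symplectic Φ hg e₁ e _ fun _ Φ' hη' hs e₁' he₁' e' ↦ by
      letI : LinearOrder (Fin (n + 1) ⊕ Fin (n + 1)) :=
        linearOrderOfOrientation (finSumFinEquiv.symm : Fin ((n + 1) + (n + 1)) ≃ Fin (n + 1) ⊕ Fin (n + 1))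
      exact hs.exists_mem_divisorClasses_corrMapT_eq_primitiveProj Φ' hη' e₁' he₁' e' r

/-- **The sign operator `Σ_r ε_r π_{m,r}`, every polarised complex torus.** [cite: Milne1999LefschetzClasses, §5 Thm. 5.9 (proof)] -/
theorem IsRiemannForm.exists_mem_divisorClasses_corrMapT_eq_lefschetzSignOp {a m g : ℕ} (hg : finrank ℂ E = g)
    (e₁ : Fin (a + m) ≃ ι) (e : Fin ((a + m) + 2 * g) ≃ ι ⊕ ι) :
    ∃ γ ∈ divisorClasses (prodPeriod Φ Φ) g, corrMapT Φ Φ e₁ e γ = lefschetzSignOp η m := by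
  rw [lefschetzSignOp]
  exact exists_mem_divisorClasses_corrMapT_eq_sum Φ e₁ e _ (fun r ↦ primitiveProj η m r)
    (fun r ↦ lefschetzSign (m - 2 * r))
    fun r _ ↦ hη.exists_mem_divisorClasses_corrMapT_eq_primitiveProj Φ hg e₁ e r

/-- **Theorem 5.9 for `∗`, every polarised complex torus, any enumerations**: Kleiman's
`∗ : Hᵐ(X) → H^{2j+m}(X)` is `ᵗγ`, `γ ∈ D^{g+j}(X × X)` (`∗ = Lʲ ∘ Σ_r ε_r π_{m,r}`; `Lʲ = ᵗ([Δ] ∧ p₂^*E^{∧j})`).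
[cite: Milne1999LefschetzClasses, §5 Thm. 5.9] [cite: Kleiman1968AlgebraicCycles, §1.4 (1.4.4)] -/
theorem IsRiemannForm.exists_mem_divisorClasses_corrMapT_eq_lefschetzStar {g : ℕ} (hg : finrank ℂ E = g)
    (j : ℕ) {a m l : ℕ} (h : 2 * j + m = l) (e₁ : Fin (a + l) ≃ ι) (e : Fin ((a + m) + 2 * (g + j)) ≃ ι ⊕ ι) :
    ∃ γ ∈ divisorClasses (prodPeriod Φ Φ) (g + j), corrMapT Φ Φ e₁ e γ = lefschetzStar η j h := by
  have hnd : ∀ v : E, v ≠ 0 → ∃ w : E, η ![v, w] ≠ 0 := fun v hv ↦ hη.exists_apply_ne_zero Φ v hv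
  have hal : a + l = 2 * g := by have h := add_eq_two_mul_finrank' Φ e₁; omega
  obtain ⟨e₁', he₁'⟩ := exists_orientationSign_eq_one Φ e₁
  set e₂ : Fin ((a + 2 * j) + m) ≃ ι := (finCongr (show (a + 2 * j) + m = a + l by omega)).trans e₁
  set e₂₃ : Fin (((a + 2 * j) + m) + 2 * g) ≃ ι ⊕ ι :=
    (finCongr (show ((a + 2 * j) + m) + 2 * g = (a + m) + 2 * (g + j) by omega)).trans e
  obtain ⟨γ, hγ, hγe⟩ := exists_mem_divisorClasses_corrMapT_eq_comp Φ hη.isNSForm hnd e₁' e₂ e e₂₃ e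
    (show l + (a + 2 * j) = 2 * (g + j) by omega) (show m + (a + 2 * j) = 2 * g by omega)
    (show l + (a + 2 * j) = 2 * (g + j) by omega)
    (exists_mem_divisorClasses_corrMapT_eq_lefschetzPow Φ hη.isNSForm hg (hη.wedgePow_ne_zero Φ hg.ge)
      hη.isNSForm j h e₁' he₁' e)
    (hη.exists_mem_divisorClasses_corrMapT_eq_lefschetzSignOp Φ hg e₂ e₂₃)
  exact ⟨γ, hγ, by rw [corrMapT_eq_of_enum₁ Φ Φ e₁ e₁' e, hγe, lefschetzStar]⟩

/-- **`Λᵗ = (Lᵗ)⁻¹`, every polarised complex torus, any enumerations**: `Λᵗ : H^{m+2t}(X) → Hᵐ(X)` is `ᵗγ`,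
`γ ∈ Dᶜ(X × X)`, `c + t = g`. [cite: Milne1999LefschetzClasses, §5 Thm. 5.9 and Rem. 5.11] [cite: Voisin2002, §11.3.3 p. 287] -/
theorem IsRiemannForm.exists_mem_divisorClasses_corrMapT_eq_kleimanDualPow {a m : ℕ} (e₁ : Fin (a + m) ≃ ι)
    (t : ℕ) {c : ℕ} (hc : c + t = finrank ℂ E) (e : Fin ((a + (m + 2 * t)) + 2 * c) ≃ ι ⊕ ι) :
    ∃ γ ∈ divisorClasses (prodPeriod Φ Φ) c, corrMapT Φ Φ e₁ e γ = kleimanDualPow η m t := by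
  rcases Nat.eq_zero_or_eq_succ_pred (finrank ℂ E) with h0 | hsucc
  · -- the point: `t = 0`, `c = 0`, `Λ⁰ = id`
    have ht : t = 0 := by omega
    have hc0 : c = 0 := by omega
    subst ht hc0
    obtain ⟨e₁', he₁'⟩ := exists_orientationSign_eq_one Φ e₁
    obtain ⟨γ, hγ, hγe⟩ :=
      exists_mem_divisorClasses_corrMapT_eq_id Φ hη.isNSForm h0 (hη.wedgePow_ne_zero Φ h0.ge) e₁' he₁' e
    exact ⟨γ, hγ, by rw [corrMapT_eq_of_enum₁ Φ Φ e₁ e₁' e, hγe]; rfl⟩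
  · exact hη.exists_mem_divisorClasses_corrMapT_of_symplectic Φ hsucc e₁ e _ fun _ Φ' hη' hs e₁' he₁' e' ↦ by
      letI : LinearOrder (Fin ((finrank ℂ E).pred + 1) ⊕ Fin ((finrank ℂ E).pred + 1)) :=
        linearOrderOfOrientation (finSumFinEquiv.symm :
          Fin (((finrank ℂ E).pred + 1) + ((finrank ℂ E).pred + 1)) ≃ _)
      exact hs.exists_mem_divisorClasses_corrMapT_eq_kleimanDualPow Φ' hη' e₁' he₁' t (by omega) e'

omit hη in
/-- **VOISIN'S HODGE CLASS OF `(L^{n-k})⁻¹` IS A LEFSCHETZ CLASS — for EVERY polarised complex torus, under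
exactly the hypotheses of row A4-49's `IsRiemannForm.corrClass_lefschetzInv_mem_hodgeClassesIn`** (there: a
Hodge class; here: in `Dᵏ(X × X)`, a `ℚ`-combination of products of divisor classes): for a Riemann form `η`
on `X = E/Φ(ℤ^ι)` (ANY lattice basis `Φ`), `k + j = g`, any `f : Fin (c + k) ≃ ι` and any left inverse `u`
of `Lʲ : Hᵏ(X) → Hᶜ(X)` (`2j + k = c`), `γ_u = corrClass Φ f u ∈ Dᵏ(X × X)`. Voisin (p. 287): "we do not know
whether the corresponding Hodge class satisfies the Hodge conjecture" — for complex tori with a polarisation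
(abelian varieties) it is a Lefschetz class (Milne 1999 Thm. 5.9 / Rem. 5.11, Lieberman 1968).
[cite: Voisin2002, §11.3.3 p. 287] [cite: Milne1999LefschetzClasses, §5 Thm. 5.9 and Rem. 5.11]
[cite: Kleiman1968AlgebraicCycles, §2 (2A11)] -/
theorem IsRiemannForm.corrClass_lefschetzInv_mem_divisorClasses (hR : IsRiemannForm Φ η) {k j c : ℕ}
    (hkj : k + j = finrank ℂ E) (h : 2 * j + k = c) (f : Fin (c + k) ≃ ι)
    (u : (E [⋀^Fin c]→L[ℝ] ℂ) →ₗ[ℂ] (E [⋀^Fin k]→L[ℝ] ℂ)) (hu : ∀ ψ, u (lefschetzPow η j h ψ) = ψ) :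
    (corrClass Φ f u).domDomCongr (finCongr (two_mul k).symm) ∈ divisorClasses (prodPeriod Φ Φ) k := by
  subst h
  have hnd : ∀ v : E, v ≠ 0 → ∃ w : E, η ![v, w] ≠ 0 := fun v hv ↦ hR.exists_apply_ne_zero Φ v hv
  -- `Λʲ = ᵗγ` with `γ ∈ Dᵏ(X × X)`
  set e : Fin (((2 * j + k) + (k + 2 * j)) + 2 * k) ≃ ι ⊕ ι :=
    (finCongr (show ((2 * j + k) + (k + 2 * j)) + 2 * k = ((2 * j + k) + k) + ((2 * j + k) + k) by omega)).trans
      (sumEnum f f)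
  obtain ⟨γ, hγ, hγΛ⟩ := hR.exists_mem_divisorClasses_corrMapT_eq_kleimanDualPow Φ f j (c := k) (by omega) e
  -- `u = ᵗγ` on `H^{2j+k}(X)`: both `u` and `Λʲ` invert `Lʲ`
  set e' : Fin (((2 * j + k) + (2 * j + k)) + 2 * k) ≃ ι ⊕ ι :=
    (finCongr (show ((2 * j + k) + (2 * j + k)) + 2 * k = ((2 * j + k) + k) + ((2 * j + k) + k) by omega)).trans
      (sumEnum f f)
  have hu' : corrMapT Φ Φ f e' γ = u := by
    refine LinearMap.ext fun ξ ↦ ?_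
    obtain ⟨y, rfl⟩ := (lefschetzPow_bijective (η := η) hnd hkj rfl).2 ξ
    have hcast : lefschetzPow η j (rfl : 2 * j + k = 2 * j + k) y =
        (lefschetzPow η j (Nat.add_comm (2 * j) k) y).domDomCongr (finCongr (Nat.add_comm k (2 * j))) := by
      rw [lefschetzPow_apply, lefschetzPow_apply, domDomCongr_finCongr_trans]
    rw [hu, hcast, corrMapT_apply_domDomCongr Φ Φ (Nat.add_comm k (2 * j)) f e e', hγΛ,
      kleimanDualPow_lefschetzPow hnd hkj.le]
  exact corrClass_domDomCongr_mem_divisorClasses_of_exists Φ f e' f (two_mul k).symm ⟨γ, hγ, hu'⟩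

/-- **The kernel class `γ_Λ` of `ᶜΛ` (skel-4's A4-54‴ object) is a Lefschetz class for EVERY polarised complex
torus.** [cite: Milne1999LefschetzClasses, §5 Thm. 5.9] [cite: Voisin2002, §11.3.3 Lemma 11.41] -/
theorem IsRiemannForm.corrClass_lefschetzDual_domDomCongr_mem_divisorClasses {m l c : ℕ}
    (hc : finrank ℂ E = c + 1) (h : l + m = 2 * c) (f : Fin ((m + 2) + l) ≃ ι) :
    (corrClass Φ f (lefschetzDual η m)).domDomCongr (finCongr h) ∈ divisorClasses (prodPeriod Φ Φ) c := by
  set e₁ : Fin ((l + 2) + m) ≃ ι := (finCongr (show (l + 2) + m = (m + 2) + l by omega)).trans f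
  set e : Fin (((l + 2) + (m + 2)) + 2 * c) ≃ ι ⊕ ι :=
    (finCongr (show ((l + 2) + (m + 2)) + 2 * c = ((m + 2) + l) + ((m + 2) + l) by omega)).trans (sumEnum f f)
  exact corrClass_domDomCongr_mem_divisorClasses_of_exists Φ e₁ e f h
    (hη.exists_mem_divisorClasses_corrMapT_eq_lefschetzDual Φ hc e₁ e)

/-- **The kernel class of Kleiman's `Λ` is a Lefschetz class for every polarised complex torus.**
[cite: Milne1999LefschetzClasses, §5 Thm. 5.9] [cite: Voisin2002, §11.3.3 Lemma 11.41] -/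
theorem IsRiemannForm.corrClass_kleimanDual_domDomCongr_mem_divisorClasses {m l c : ℕ}
    (hc : finrank ℂ E = c + 1) (h : l + m = 2 * c) (f : Fin ((m + 2) + l) ≃ ι) :
    (corrClass Φ f (kleimanDual η m)).domDomCongr (finCongr h) ∈ divisorClasses (prodPeriod Φ Φ) c := by
  set e₁ : Fin ((l + 2) + m) ≃ ι := (finCongr (show (l + 2) + m = (m + 2) + l by omega)).trans f
  set e : Fin (((l + 2) + (m + 2)) + 2 * c) ≃ ι ⊕ ι :=
    (finCongr (show ((l + 2) + (m + 2)) + 2 * c = ((m + 2) + l) + ((m + 2) + l) by omega)).trans (sumEnum f f)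
  exact corrClass_domDomCongr_mem_divisorClasses_of_exists Φ e₁ e f h
    (hη.exists_mem_divisorClasses_corrMapT_eq_kleimanDual Φ hc e₁ e)

/-- **The kernel classes of the primitive projectors are Lefschetz classes for every polarised complex torus.**
[cite: Milne1999LefschetzClasses, §5 Thm. 5.9 (proof)] [cite: Voisin2002, §11.3.3 Lemma 11.41] -/
theorem IsRiemannForm.corrClass_primitiveProj_domDomCongr_mem_divisorClasses {m l g : ℕ} (hg : finrank ℂ E = g)
    (h : l + m = 2 * g) (f : Fin (m + l) ≃ ι) (r : ℕ) :
    (corrClass Φ f (primitiveProj η m r)).domDomCongr (finCongr h) ∈ divisorClasses (prodPeriod Φ Φ) g := by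
  set e₁ : Fin (l + m) ≃ ι := (finCongr (show l + m = m + l by omega)).trans f
  set e : Fin ((l + m) + 2 * g) ≃ ι ⊕ ι :=
    (finCongr (show (l + m) + 2 * g = (m + l) + (m + l) by omega)).trans (sumEnum f f)
  exact corrClass_domDomCongr_mem_divisorClasses_of_exists Φ e₁ e f h
    (hη.exists_mem_divisorClasses_corrMapT_eq_primitiveProj Φ hg e₁ e r)

/-- **The kernel class of `Λᵗ` (`c + t = g`) is a Lefschetz class for every polarised complex torus.**
[cite: Milne1999LefschetzClasses, §5 Rem. 5.11] [cite: Voisin2002, §11.3.3 p. 287] -/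
theorem IsRiemannForm.corrClass_kleimanDualPow_domDomCongr_mem_divisorClasses {m l : ℕ} (t : ℕ) {c : ℕ}
    (hc : c + t = finrank ℂ E) (h : l + m = 2 * c) (f : Fin ((m + 2 * t) + l) ≃ ι) :
    (corrClass Φ f (kleimanDualPow η m t)).domDomCongr (finCongr h) ∈ divisorClasses (prodPeriod Φ Φ) c := by
  set e₁ : Fin ((l + 2 * t) + m) ≃ ι := (finCongr (show (l + 2 * t) + m = (m + 2 * t) + l by omega)).trans f
  set e : Fin (((l + 2 * t) + (m + 2 * t)) + 2 * c) ≃ ι ⊕ ι :=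
    (finCongr (show ((l + 2 * t) + (m + 2 * t)) + 2 * c = ((m + 2 * t) + l) + ((m + 2 * t) + l) by
      omega)).trans (sumEnum f f)
  exact corrClass_domDomCongr_mem_divisorClasses_of_exists Φ e₁ e f h
    (hη.exists_mem_divisorClasses_corrMapT_eq_kleimanDualPow Φ e₁ t hc e)

end AnyBasis

/-! ## §4 `D•(X)` is stable under the Lefschetz algebra, for every polarised complex torus -/

section Stable

universe uE

variable {ι : Type*} [Fintype ι] [DecidableEq ι] {E : Type uE} [NormedAddCommGroup E] [NormedSpace ℂ E]
  [FiniteDimensional ℂ E] (Φ : (ι → ℝ) ≃L[ℝ] E) {η : E [⋀^Fin 2]→L[ℝ] ℝ} (hη : IsRiemannForm Φ η)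
include hη

omit [DecidableEq ι] [FiniteDimensional ℂ E] hη in
include Φ in
/-- Cardinality bookkeeping: `|ι| = 2 dim_ℂ E`. [cite: Lange2023AbelianVarietiesComplex, §1.1.3] -/
private theorem card_eq_two_mul_finrank' : Fintype.card ι = 2 * finrank ℂ E := by
  have h := finrank_complex_mul_two Φ (Fintype.equivFin ι).symm
  omega

/-- **`ᶜΛ` maps `D^{s+1}(X)` into `Dˢ(X)`** for every polarised complex torus (Milne 1999, Prop. 5.7 and
Thm. 5.9: `ᶜΛ = ᵗγ` with `γ` a Lefschetz class, and Lefschetz correspondences preserve Lefschetz classes).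
[cite: Milne1999LefschetzClasses, §5 Prop. 5.7 and Thm. 5.9] -/
theorem IsRiemannForm.lefschetzDual_apply_mem_divisorClasses {s : ℕ} {x : E [⋀^Fin (2 * s + 2)]→L[ℝ] ℂ}
    (hx : x ∈ divisorClasses Φ (s + 1)) : lefschetzDual η (2 * s) x ∈ divisorClasses Φ s := by
  have hnd : ∀ v : E, v ≠ 0 → ∃ w : E, η ![v, w] ≠ 0 := fun v hv ↦ hη.exists_apply_ne_zero Φ v hv
  have hcard := card_eq_two_mul_finrank' Φ
  rcases Nat.eq_zero_or_eq_succ_pred (finrank ℂ E) with h0 | hsucc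
  · rw [eq_zero_of_card_lt Φ x (by omega), map_zero]
    exact Submodule.zero_mem _
  · by_cases hs : s ≤ finrank ℂ E
    · set g := finrank ℂ E
      let e₁ : Fin ((2 * g - 2 * s) + 2 * s) ≃ ι :=
        (Fintype.equivOfCardEq (by simp only [Fintype.card_fin]; omega)).symm
      let e : Fin (((2 * g - 2 * s) + (2 * s + 2)) + 2 * g.pred) ≃ ι ⊕ ι :=
        (Fintype.equivOfCardEq (by simp only [Fintype.card_fin, Fintype.card_sum]; omega)).symm
      exact apply_mem_divisorClasses_of_exists_corrMapT Φ hη.isNSForm hnd (s := s + 1) e₁ e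
        (hη.exists_mem_divisorClasses_corrMapT_eq_lefschetzDual Φ hsucc e₁ e) hx
    · rw [eq_zero_of_card_lt Φ (lefschetzDual η (2 * s) x) (by omega)]
      exact Submodule.zero_mem _

/-- **Kleiman's `Λ` maps `D^{s+1}(X)` into `Dˢ(X)`** for every polarised complex torus.
[cite: Milne1999LefschetzClasses, §5 Prop. 5.7 and Thm. 5.9] [cite: Kleiman1968AlgebraicCycles, §1.4] -/
theorem IsRiemannForm.kleimanDual_apply_mem_divisorClasses {s : ℕ} {x : E [⋀^Fin (2 * s + 2)]→L[ℝ] ℂ}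
    (hx : x ∈ divisorClasses Φ (s + 1)) : kleimanDual η (2 * s) x ∈ divisorClasses Φ s := by
  have hnd : ∀ v : E, v ≠ 0 → ∃ w : E, η ![v, w] ≠ 0 := fun v hv ↦ hη.exists_apply_ne_zero Φ v hv
  have hcard := card_eq_two_mul_finrank' Φ
  rcases Nat.eq_zero_or_eq_succ_pred (finrank ℂ E) with h0 | hsucc
  · rw [eq_zero_of_card_lt Φ x (by omega), map_zero]
    exact Submodule.zero_mem _
  · by_cases hs : s ≤ finrank ℂ E
    · set g := finrank ℂ E
      let e₁ : Fin ((2 * g - 2 * s) + 2 * s) ≃ ι :=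
        (Fintype.equivOfCardEq (by simp only [Fintype.card_fin]; omega)).symm
      let e : Fin (((2 * g - 2 * s) + (2 * s + 2)) + 2 * g.pred) ≃ ι ⊕ ι :=
        (Fintype.equivOfCardEq (by simp only [Fintype.card_fin, Fintype.card_sum]; omega)).symm
      exact apply_mem_divisorClasses_of_exists_corrMapT Φ hη.isNSForm hnd (s := s + 1) e₁ e
        (hη.exists_mem_divisorClasses_corrMapT_eq_kleimanDual Φ hsucc e₁ e) hx
    · rw [eq_zero_of_card_lt Φ (kleimanDual η (2 * s) x) (by omega)]
      exact Submodule.zero_mem _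

/-- **The primitive projectors map `Dˢ(X)` into `Dˢ(X)`** for every polarised complex torus: the primitive
(Lefschetz) decomposition of a divisor-class power is by divisor-class powers.
[cite: Milne1999LefschetzClasses, §5 Prop. 5.7 and Thm. 5.9] [cite: Kleiman1968AlgebraicCycles, §1.4 (1.4.4)] -/
theorem IsRiemannForm.primitiveProj_apply_mem_divisorClasses {s : ℕ} (r : ℕ) {x : E [⋀^Fin (2 * s)]→L[ℝ] ℂ}
    (hx : x ∈ divisorClasses Φ s) : primitiveProj η (2 * s) r x ∈ divisorClasses Φ s := by
  have hnd : ∀ v : E, v ≠ 0 → ∃ w : E, η ![v, w] ≠ 0 := fun v hv ↦ hη.exists_apply_ne_zero Φ v hv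
  have hcard := card_eq_two_mul_finrank' Φ
  by_cases hs : s ≤ finrank ℂ E
  · set g := finrank ℂ E
    let e₁ : Fin ((2 * g - 2 * s) + 2 * s) ≃ ι :=
      (Fintype.equivOfCardEq (by simp only [Fintype.card_fin]; omega)).symm
    let e : Fin (((2 * g - 2 * s) + 2 * s) + 2 * g) ≃ ι ⊕ ι :=
      (Fintype.equivOfCardEq (by simp only [Fintype.card_fin, Fintype.card_sum]; omega)).symm
    exact apply_mem_divisorClasses_of_exists_corrMapT Φ hη.isNSForm hnd e₁ e
      (hη.exists_mem_divisorClasses_corrMapT_eq_primitiveProj Φ rfl e₁ e r) hx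
  · rw [eq_zero_of_card_lt Φ x (by omega), map_zero]
    exact Submodule.zero_mem _

/-- **Kleiman's `∗` maps `Dˢ(X)` into `D^{j+s}(X)`** for every polarised complex torus.
[cite: Milne1999LefschetzClasses, §5 Prop. 5.7 and Thm. 5.9] [cite: Kleiman1968AlgebraicCycles, §1.4 (1.4.4)] -/
theorem IsRiemannForm.lefschetzStar_apply_mem_divisorClasses (j : ℕ) {s : ℕ} (h : 2 * j + 2 * s = 2 * (j + s))
    {x : E [⋀^Fin (2 * s)]→L[ℝ] ℂ} (hx : x ∈ divisorClasses Φ s) :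
    lefschetzStar η j h x ∈ divisorClasses Φ (j + s) := by
  have hnd : ∀ v : E, v ≠ 0 → ∃ w : E, η ![v, w] ≠ 0 := fun v hv ↦ hη.exists_apply_ne_zero Φ v hv
  have hcard := card_eq_two_mul_finrank' Φ
  by_cases hs : j + s ≤ finrank ℂ E
  · set g := finrank ℂ E
    let e₁ : Fin ((2 * g - 2 * (j + s)) + 2 * (j + s)) ≃ ι :=
      (Fintype.equivOfCardEq (by simp only [Fintype.card_fin]; omega)).symm
    let e : Fin (((2 * g - 2 * (j + s)) + 2 * s) + 2 * (g + j)) ≃ ι ⊕ ι :=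
      (Fintype.equivOfCardEq (by simp only [Fintype.card_fin, Fintype.card_sum]; omega)).symm
    exact apply_mem_divisorClasses_of_exists_corrMapT Φ hη.isNSForm hnd e₁ e
      (hη.exists_mem_divisorClasses_corrMapT_eq_lefschetzStar Φ rfl j h e₁ e) hx
  · rw [eq_zero_of_card_lt Φ (lefschetzStar η j h x) (by omega)]
    exact Submodule.zero_mem _

end Stable

/-! ## §5 Example: products of polarised tori (no symplectic basis of the product lattice needed) -/

section Product

universe uE

variable {ι₁ ι₂ : Type*} [Fintype ι₁] [Fintype ι₂] [DecidableEq ι₁] [DecidableEq ι₂]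
  {E₁ E₂ : Type uE} [NormedAddCommGroup E₁] [NormedSpace ℂ E₁] [NormedAddCommGroup E₂] [NormedSpace ℂ E₂]
  [FiniteDimensional ℂ E₁] [FiniteDimensional ℂ E₂]
  (Φ₁ : (ι₁ → ℝ) ≃L[ℝ] E₁) (Φ₂ : (ι₂ → ℝ) ≃L[ℝ] E₂) {ω₁ : E₁ [⋀^Fin 2]→L[ℝ] ℝ} {ω₂ : E₂ [⋀^Fin 2]→L[ℝ] ℝ}

/-- **Kleiman's `Λ` of a product of polarised complex tori `X₁ × X₂` (polarisation `p₁^*ω₁ + p₂^*ω₂`) is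
induced by a Lefschetz correspondence on `(X₁ × X₂) × (X₁ × X₂)`** — the product lattice basis
`Φ₁ × Φ₂` is not symplectic for `p₁^*ω₁ + p₂^*ω₂`, which is exactly what §3 allows (the product is again
a polarised complex torus, `IsRiemannForm.prod`). [cite: Milne1999LefschetzClasses, §5 Thm. 5.9]
[cite: Kleiman1968AlgebraicCycles, §2 (2A11)] -/
theorem IsRiemannForm.exists_mem_divisorClasses_corrMapT_eq_kleimanDual_prod (h₁ : IsRiemannForm Φ₁ ω₁)
    (h₂ : IsRiemannForm Φ₂ ω₂) {a m c : ℕ} (hc : finrank ℂ (E₁ × E₂) = c + 1) (e₁ : Fin (a + m) ≃ ι₁ ⊕ ι₂)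
    (e : Fin ((a + (m + 2)) + 2 * c) ≃ (ι₁ ⊕ ι₂) ⊕ (ι₁ ⊕ ι₂)) :
    ∃ γ ∈ divisorClasses (prodPeriod (prodPeriod Φ₁ Φ₂) (prodPeriod Φ₁ Φ₂)) c,
      corrMapT (prodPeriod Φ₁ Φ₂) (prodPeriod Φ₁ Φ₂) e₁ e γ = kleimanDual (prodForm ω₁ ω₂) m :=
  (h₁.prod h₂).exists_mem_divisorClasses_corrMapT_eq_kleimanDual (prodPeriod Φ₁ Φ₂) hc e₁ e

end Product


end ComplexTorus

end Literature.Geometry.Kaehler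

end
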